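import Summits.AnomalousDissipation.AnomalousDissipation.Theorems.SolenoidalFractalHomogenisationLagrangianStepVmodLossAdjOnsetGarding
import HarnessLib

/-!
# K1L_D (stmt-AnomalousDissipation-27980), (ℓ3-A) road A, (S2-adj) glue: the ONSET WINDOW bound —
# `2·c·m·τ − N·M·τ² ≤ lossAdj (T s t₀) [J(t₀)•φ₀]` on every final stretch `τ ≤ t₀ − s`, from UNIFORM bounds `m ≤ ‖∇(J(t₀−σ)•φ₀)‖₂²`, `‖g_σ‖₂ ≤ M`
(helper; `--supports 27980 --as helper`; prover ad-k1loc-p3 g12; closes the (S2-adj) glue chain p730365 → p731106 → p731429 → p732357 → p732954 → p733122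
into ONE consumable statement: everything left is two sup-type bounds on explicit smooth data.)

CONVENTION (D28-8′): derivative-index distortion `Torus.Visc4.conj`; constraint `∇·(G v) = 0`.

From ONE call of the onset core (p732357; the witness must be shared): (i) `0 ≤ D(σ)` a.e. (`λ = 0`); (ii) the gradient-currency onset bound
`c·gradNormSq (J(t₀−σ)•φ₀) − σ·N·‖g_σ‖₂ ≤ D(σ)` a.e. (the steps of p732954/p733122 on the shared witness); (iii) `D` integrable on `(0,t₀)`
(`integrableOn_dissipation`, p730365); (iv) with uniform bounds `m ≤ gradNormSq (J(t₀−σ)•φ₀)` and `‖g_σ‖_{L²} ≤ M` for a.e. `σ ∈ (0,t₀)` and `c ≥ 0`: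
the affine minorant `f(σ) = c·m − N·M·σ ≤ D(σ)` is integrable on every `(0,τ]`, so `two_setIntegral_le_of_le_density` gives
**`2·c·m·τ − N·M·τ² ≤ lossAdj (T s t₀) ζ`** for all `s ∈ [0,t₀)`, `0 ≤ τ ≤ t₀ − s` — i.e. `lossAdj ≥ c·m·τ` on the onset window `τ ≤ c·m/(N·M)`.
* **`EnergyDuhamelG.lossAdj_ge_onsetWindow`**.
`sorry`-free; NOT a proof of any block, of K1L_D or of AD; rung F-D1.A0.
-/

set_option linter.dupNamespace false

noncomputable section

namespace Summit.AnomalousDissipation.AnomalousDissipation.Theorems.SolenoidalFractalHomogenisation.LagrangianStep.VmodDist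

open Literature.Analysis Literature.Analysis.FluidPDE Literature.Analysis.FunctionSpaces
open MeasureTheory Set Filter Function
open scoped ENNReal NNReal InnerProductSpace
open Summit.AnomalousDissipation.AnomalousDissipation.Theorems.SolenoidalFractalHomogenisation.LagrangianStep.CellClauseMod
open Summit.AnomalousDissipation.AnomalousDissipation.Theorems.SolenoidalFractalHomogenisation.LagrangianStep.CellEnergyT

variable {Tw θ nC : ℝ} {𝔸U 𝔸T : Torus.Visc4 (Fin 3)} {bU : ℝ → VF} {G J J' : ℝ → UnitAddTorus (Fin 3) → Matrix (Fin 3) (Fin 3) ℝ}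
  {U T : ℝ → ℝ → (V2 →L[ℝ] V2)} {φ₀ : VF}

/-- The integral of the affine minorant over a final stretch: `∫_{(0,τ]} (a − b σ) dσ = a τ − b τ²/2`. -/
theorem setIntegral_Ioc_affine (a b : ℝ) {τ : ℝ} (hτ : 0 ≤ τ) : ∫ σ in Ioc 0 τ, (a - b * σ) = a * τ - b * τ ^ 2 / 2 := by
  rw [← intervalIntegral.integral_of_le hτ]
  have hf : IntervalIntegrable (fun _ : ℝ => a) volume 0 τ := intervalIntegrable_const
  have hg : IntervalIntegrable (fun σ : ℝ => b * σ) volume 0 τ := (by fun_prop : Continuous fun σ : ℝ => b * σ).intervalIntegrable 0 τ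
  have h1 := intervalIntegral.integral_sub hf hg
  have h2 : ∫ σ in (0 : ℝ)..τ, b * σ = b * (τ ^ 2 / 2) := by
    rw [intervalIntegral.integral_const_mul, integral_id]; ring
  have h3 : ∫ _ in (0 : ℝ)..τ, a = τ * a := by rw [intervalIntegral.integral_const]; simp
  calc ∫ σ in (0 : ℝ)..τ, (a - b * σ) = (∫ _ in (0 : ℝ)..τ, a) - ∫ σ in (0 : ℝ)..τ, b * σ := h1
    _ = a * τ - b * τ ^ 2 / 2 := by rw [h2, h3]; ring

set_option maxHeartbeats 1600000 in
/-- **(S2-adj) ONSET WINDOW BOUND.**  Under the hypotheses of `EnergyDuhamelG.exists_adjWitness_onsetGarding` (p733122), jointly continuous frame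
entries, and UNIFORM bounds for a.e. `σ ∈ (0,t₀)` — `m ≤ gradNormSq (J(t₀−σ)•φ₀)` and `‖g_σ‖_{L²} ≤ M` (`g_σ = 𝓛^{𝔸T^G,*}χ_σ + 𝓛^{(𝔸Tᵀ)^G,*}χ_σ`,
`χ_σ = J(t₀−σ)•φ₀`) — with `0 ≤ c = lo − η − (lo−η+h+h²/η)(3θ)² − h(6θ+9θ²)`:  for every `s ∈ [0,t₀)` and `0 ≤ τ ≤ t₀ − s`,
`2·c·m·τ − N·M·τ² ≤ lossAdj (T s t₀) [J(t₀)•φ₀]`. -/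
theorem EnergyDuhamelG.lossAdj_ge_onsetWindow (hED : EnergyDuhamelG Tw 𝔸U 𝔸T bU G U T)
    (hT : IsDistortedPropagator Tw 𝔸T (fun _ _ => 0) G T) (hG : IsFrameModulation θ Tw nC G) (hR : IsFrameRegular θ Tw nC G J)
    (hsolT : ∀ s, 0 ≤ s → s < Tw → ∀ (φ : VF) (hφ : MemLp φ 2 volume), Torus.IsWeaklyDivFree (Torus.distort (G s) φ) → ∃ w : ℝ → VF,
      Torus.IsWeakTensorPassiveVectorDistortedOn 0 (Tw - s) 𝔸T (fun _ _ => 0) (fun τ => G (s + τ)) φ w)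
    (hQ : ∀ ξ : Fin 3 → Fin 3 → ℝ, 0 ≤ ∑ l, ∑ i, ∑ c, ∑ e, 𝔸T i c l e * ξ c i * ξ e l)
    {lo hi h η : ℝ} (h𝔸 : Torus.NearIso 𝔸T lo hi) (hB : Torus.FullBound 𝔸T h) (hh : 0 ≤ h) (hη : 0 < η) (hηlo : η ≤ lo)
    (hc : 0 ≤ lo - η - (lo - η + h + h ^ 2 / η) * (3 * θ) ^ 2 - h * (2 * (3 * θ) + (3 * θ) ^ 2))
    (hφs : Torus.IsSmooth φ₀) (hφdiv : Torus.IsDivFree φ₀)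
    (hJ' : ∀ᵐ t ∂(volume.restrict (Ioo 0 Tw)), ∀ y, HasDerivAt (fun s => J s y) (J' t y) t)
    {N : ℝ} (hN0 : 0 ≤ N)
    (hN : ∀ᵐ τ ∂(volume.restrict (Ioo 0 Tw)),
      MemLp (fun x => Torus.distort (J' τ) φ₀ x + Torus.convect (fun _ => 0) (Torus.distort (J τ) φ₀) x +
          Torus.viscAdjVar (fun y => Torus.Visc4.conj (G τ y) 𝔸T) (Torus.distort (J τ) φ₀) x) 2 volume ∧
      eLpNorm (fun x => Torus.distort (J' τ) φ₀ x + Torus.convect (fun _ => 0) (Torus.distort (J τ) φ₀) x +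
          Torus.viscAdjVar (fun y => Torus.Visc4.conj (G τ y) 𝔸T) (Torus.distort (J τ) φ₀) x) 2 volume ≤ ENNReal.ofReal N)
    {t₀ : ℝ} (ht₀ : 0 < t₀) (ht₀T : t₀ ≤ Tw)
    {m M : ℝ} (hm : ∀ᵐ σ ∂(volume.restrict (Ioo 0 t₀)), m ≤ Torus.gradNormSq (Torus.distort (J (t₀ - σ)) φ₀))
    (hgM : ∀ᵐ σ ∂(volume.restrict (Ioo 0 t₀)),
      (eLpNorm (fun x => Torus.viscAdjVar (fun y => Torus.Visc4.conj (G (t₀ - σ) y) 𝔸T) (Torus.distort (J (t₀ - σ)) φ₀) x +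
        Torus.viscAdjVar (fun y => Torus.Visc4.conj (G (t₀ - σ) y) (Torus.majorTranspose 𝔸T)) (Torus.distort (J (t₀ - σ)) φ₀) x) 2 volume).toReal ≤ M)
    {s : ℝ} (hs : s ∈ Ico 0 t₀) {τ : ℝ} (hτ0 : 0 ≤ τ) (hτ : τ ≤ t₀ - s) :
    2 * (lo - η - (lo - η + h + h ^ 2 / η) * (3 * θ) ^ 2 - h * (2 * (3 * θ) + (3 * θ) ^ 2)) * m * τ - N * M * τ ^ 2
      ≤ lossAdj (T s t₀) (((Torus.isSmooth_distort (hR.smooth t₀) hφs).memLp 2).toLp (Torus.distort (J t₀) φ₀)) := by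
  set c := lo - η - (lo - η + h + h ^ 2 / η) * (3 * θ) ^ 2 - h * (2 * (3 * θ) + (3 * θ) ^ 2) with hcdef
  have hTw : 0 ≤ Tw := ht₀.le.trans ht₀T
  have hθ0 : 0 ≤ θ := le_trans (abs_nonneg _) (hG.near_one 0 ⟨le_rfl, hTw⟩ 0 0 0)
  have hGs : ∀ t i j, Torus.IsSmooth (fun y => G t y i j) := fun t i j => hG.smooth_all hTw t i j
  obtain ⟨Ψ, DΨ, hcl, hM, hD, hloss, hae⟩ := hED.exists_adjWitness_onsetCore hT hG hR hsolT hQ hφs hφdiv hJ' hN0 hN ht₀ ht₀T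
  -- (iii) integrability of the density
  have h𝔅c : ∀ i c' l e, Continuous (uncurry fun σ y => Torus.Visc4.conj (G (t₀ - σ) y) (Torus.majorTranspose 𝔸T) i c' l e) := by
    intro i c' l e
    have hGc' : ∀ i j, Continuous (uncurry fun σ y => G (t₀ - σ) y i j) := fun i j =>
      (hG.continuous_uncurry_entry hTw i j).comp ((continuous_const.sub continuous_fst).prodMk continuous_snd)
    exact Torus.continuous_uncurry_conj_entry hGc' _ i c' l e
  have hDi := integrableOn_dissipation h𝔅c hM
  -- (i) + (ii): nonnegativity and the gradient-currency bound, a.e., on the SHARED witness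
  have h𝔸t : Torus.NearIso (Torus.majorTranspose 𝔸T) lo hi := (Torus.nearIso_majorTranspose_iff 𝔸T lo hi).2 h𝔸
  have hBt : Torus.FullBound (Torus.majorTranspose 𝔸T) h := Torus.fullBound_majorTranspose hB
  have hpt : ∀ᵐ σ ∂(volume.restrict (Ioo 0 t₀)), 0 ≤ ∫ x, ∑ l, ∑ i, ∑ c', ∑ e,
        Torus.Visc4.conj (G (t₀ - σ) x) (Torus.majorTranspose 𝔸T) i c' l e * (DΨ σ c' x) i * (DΨ σ e x) l ∧
      c * m - N * M * σ ≤ ∫ x, ∑ l, ∑ i, ∑ c', ∑ e,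
        Torus.Visc4.conj (G (t₀ - σ) x) (Torus.majorTranspose 𝔸T) i c' l e * (DΨ σ c' x) i * (DΨ σ e x) l := by
    filter_upwards [hae, hm, hgM, ae_restrict_mem measurableSet_Ioo] with σ hσ hmσ hMσ hσm
    have hmem : t₀ - σ ∈ Icc 0 Tw := ⟨by linarith [hσm.2], by linarith [hσm.1]⟩
    set χ : VF := Torus.distort (J (t₀ - σ)) φ₀ with hχdef
    have hχs : Torus.IsSmooth χ := Torus.isSmooth_distort (hR.smooth (t₀ - σ)) hφs
    refine ⟨by simpa using hσ χ hχs 0 le_rfl, ?_⟩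
    have key := hσ χ hχs 1 zero_le_one
    have h𝔹 : ∀ i c' j e, Torus.IsSmooth (fun y => Torus.Visc4.conj (G (t₀ - σ) y) 𝔸T i c' j e) :=
      fun i c' j e => isSmooth_conj_field (hGs (t₀ - σ)) _ i c' j e
    have hdiag := neg_integral_inner_viscAdjVar_add_transpose_self h𝔹 hχs
    have eT : (fun y => Torus.majorTranspose (Torus.Visc4.conj (G (t₀ - σ) y) 𝔸T))
        = fun y => Torus.Visc4.conj (G (t₀ - σ) y) (Torus.majorTranspose 𝔸T) := by
      funext y; rw [Torus.Visc4.conj_majorTranspose]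
    rw [eT] at hdiag
    have eQ : ∫ x, ∑ l, ∑ i, ∑ c', ∑ e, Torus.Visc4.conj (G (t₀ - σ) x) 𝔸T i c' l e * (Torus.partialDeriv c' χ x) i * (Torus.partialDeriv e χ x) l
        = ∫ x, ∑ l, ∑ i, ∑ c', ∑ e, Torus.Visc4.conj (G (t₀ - σ) x) (Torus.majorTranspose 𝔸T) i c' l e
            * (Torus.partialDeriv c' χ x) i * (Torus.partialDeriv e χ x) l := by
      refine integral_congr_ae (Eventually.of_forall fun x => ?_)
      beta_reduce
      rw [Torus.Visc4.conj_majorTranspose, quadForm_majorTranspose]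
    rw [eQ] at hdiag
    rw [hdiag] at key
    have hfloor := integral_quadForm_conj_ge_gradNormSq h𝔸t hBt hh hη hηlo (Gs := G (t₀ - σ))
      (fun c' a => hG.smooth _ hmem c' a) (fun a => hG.piola _ hmem a) hθ0 (fun y c' a => hG.near_one _ hmem y c' a)
      hχs (correctedTest_isDivFree hR.mul_eq_one hφdiv (t₀ - σ))
    have h1 : c * m ≤ c * Torus.gradNormSq χ := mul_le_mul_of_nonneg_left hmσ hc
    have h2 : σ * N * (eLpNorm (fun x => Torus.viscAdjVar (fun y => Torus.Visc4.conj (G (t₀ - σ) y) 𝔸T) χ x +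
        Torus.viscAdjVar (fun y => Torus.Visc4.conj (G (t₀ - σ) y) (Torus.majorTranspose 𝔸T)) χ x) 2 volume).toReal ≤ N * M * σ := by
      have := mul_le_mul_of_nonneg_left hMσ (mul_nonneg hσm.1.le hN0)
      linarith
    linarith
  -- (iv) integrate the affine minorant on the final stretch `(0, τ]`
  have hτL : τ ≤ t₀ - s := hτ
  have hD0' : ∀ᵐ σ ∂(volume.restrict (Ioo 0 (t₀ - s))), 0 ≤ ∫ x, ∑ l, ∑ i, ∑ c', ∑ e,
      Torus.Visc4.conj (G (t₀ - σ) x) (Torus.majorTranspose 𝔸T) i c' l e * (DΨ σ c' x) i * (DΨ σ e x) l :=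
    ae_restrict_of_ae_restrict_of_subset (Ioo_subset_Ioo le_rfl (by linarith [hs.1])) (hpt.mono fun σ h => h.1)
  have hDi' := hDi.mono_set (Ioo_subset_Ioo le_rfl (by linarith [hs.1] : t₀ - s ≤ t₀))
  have hf : ∀ᵐ σ ∂(volume.restrict (Ioo 0 τ)), c * m - N * M * σ ≤ ∫ x, ∑ l, ∑ i, ∑ c', ∑ e,
      Torus.Visc4.conj (G (t₀ - σ) x) (Torus.majorTranspose 𝔸T) i c' l e * (DΨ σ c' x) i * (DΨ σ e x) l :=
    ae_restrict_of_ae_restrict_of_subset (Ioo_subset_Ioo le_rfl (by linarith [hs.1])) (hpt.mono fun σ h => h.2)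
  have hfi : IntegrableOn (fun σ => c * m - N * M * σ) (Ioc 0 τ) volume :=
    (continuous_const.sub (continuous_const.mul continuous_id)).integrableOn_Ioc
  have key := two_setIntegral_le_of_le_density (hloss s hs) hD0' hDi' hτL hfi hf
  rw [setIntegral_Ioc_affine _ _ hτ0] at key
  linarith

end Summit.AnomalousDissipation.AnomalousDissipation.Theorems.SolenoidalFractalHomogenisation.LagrangianStep.VmodDist

end
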